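import Literature.NumberTheory.Automorphic.AdelicHeightGLProofs
import Literature.NumberTheory.Automorphic.ArchimedeanDetIntegral
import Literature.NumberTheory.Automorphic.GLnAdelicStructureProofs
import Literature.NumberTheory.Automorphic.AutomorphicTwistSatake
import Literature.NumberTheory.Automorphic.IdeleClassGroupProofs
import Literature.NumberTheory.GaloisRepresentations.HeckeCharacterNormCharacter
import Literature.NumberTheory.GaloisRepresentations.HeckeCharacterNormTwistProofs
import Literature.Analysis.Matrix.DetExp
import HarnessLib

/-!
# The idelic norm of the determinant on `GL_n(𝔸_K)`: the characters `|det|_𝔸^s`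

Topic `NumberTheory/Automorphic`. For the general linear group over the adeles of a number field
`K` and `s ∈ ℂ`, the quasi-character `g ↦ |det g|_𝔸^s` of `GL_n(𝔸_K)` (trivial on `GL_n(K)` by
the product formula) is the character by which one twists a cuspidal automorphic representation
to normalise its central character on the split component `A_G = ℝ_{>0}`: "every cuspidal
representation is `π₀ ⊗ |det|^s` with `π₀` unitary" (Borel–Jacquet 1979, 5.7), the step "We may
assume `π, π'` unitary" of Arthur–Clozel 1989, Ch. 3, proof of Thm. 3.1. This file supplies the
group-theoretic facts about `|det|_𝔸` on `GL_n(𝔸_K)` consumed by that construction (all proved,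
no definitions: the norm-power Hecke characters are packaged existentially):

* `exists_heckeCharacter_ideleNorm_cpow` — for `s ∈ ℂ` there is a Hecke character `χ_s` of `K`
  with `χ_s(x) = ‖x‖^s` (Tate's quasi-characters `|𝔞|^s`, trivial on `𝕀_K¹`).
* `ideleNorm_det_ofFinite_eq_one_of_isCompact` — `|det u|_𝔸 = 1` on every compact subgroup of
  `GL_n(𝔸_K^∞)` (its image in `ℝ_{>0}` is a bounded subgroup), so `|det|^s` is trivial on every
  level.
* `ideleNorm_det_posRealScalar` — `|det a|_𝔸 = a^{n [K:ℚ]}` on `A_G`.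
* `ideleNorm_det_heckeDiagAt` — `|det t_{v,i}|_𝔸 = q_v^{-i}` (`det t_{v,i} = ϖ_v^i`).
* `norm_eq_mixedEmbedding_norm_ringEquiv_mixedSpace` — the norm of the infinite adele ring is the
  norm of the mixed space under Mathlib's `ringEquiv_mixedSpace`;
  `ideleNorm_det_ofInfinite` — `|det (g_∞, 1)|_𝔸 = N(det g_∞)` (`mixedEmbedding.norm`);
  `exists_linearMap_ideleNorm_det_ofInfinite_expGL` — **`|det (exp X, 1)|_𝔸 = e^{λ(X)}`** for a
  real linear form `λ` on `𝔤𝔩_n(K_∞)` vanishing on commutators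
  (`λ(X) = ∑_{w real} tr X_w + ∑_{w complex} 2 re tr X_w`, from `det (exp X) = exp (tr X)`,
  `Literature.Analysis.Matrix.det_exp_eq_exp_trace`): the input of `ArchimedeanCharacterTwist`.
* `ideleNorm_det_le_height`, `ideleNorm_det_inv_le_height`, `exists_ideleNorm_det_rpow_le_height` —
  **`|det g|_𝔸^{±1} ≤ (n!)^{[K:ℚ]} (1 ⊔ ‖g‖)^{n[K:ℚ]}`** for Borel–Jacquet's adelic height `‖g‖`
  (`adelicHeightGL`), hence `|det g|_𝔸^σ ≤ C (1 ⊔ ‖g‖)^r`: the moderate growth of `|det|_𝔸^s`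
  (Hadamard/Leibniz bounds: `norm_det_le_of_forall_norm_le` of `ArchimedeanDetIntegral` at the
  archimedean places, `norm_det_le_pow_of_isUltrametricDist` at the finite places).

## References

* A. Borel, H. Jacquet, *Automorphic forms and automorphic representations*, Proc. Sympos. Pure
  Math. 33 (1979), part 1, §4.2, 5.7 [BorelJacquetCorvallis1979].
* J. Tate, *Fourier analysis in number fields and Hecke's zeta-functions*, in Cassels–Fröhlich
  (1967), Ch. XV, §4.3 (the quasi-characters `|𝔞|^s`) [TateThesis1967].
* J. Arthur, L. Clozel, *Simple algebras, base change, and the advanced theory of the trace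
  formula* (1989), Ch. 3, proof of Thm. 3.1 [ArthurClozelAMS120].
-/

noncomputable section

open scoped MatrixGroups NNReal Classical
open NumberField NumberField.InfinitePlace NumberField.mixedEmbedding IsDedekindDomain NormedSpace

namespace Literature.NumberTheory.Automorphic

open Literature.NumberTheory.GaloisRepresentations (HeckeCharacter ideleGroup localUnits)

variable {n : ℕ} {K : Type} [Field K] [NumberField K]

/-! ### The quasi-characters `‖·‖^s` of the idele class group -/

variable (K) in
/-- **The norm-power Hecke characters `‖·‖^s`, `s ∈ ℂ`** (Tate (1950), §4.3: "the quasi-characters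
which are trivial on `J` are exactly those of the form `c(𝔞) = |𝔞|^s`"): for every complex `s`
there is a Hecke character `χ_s` of `K` with `χ_s(x) = ‖x‖^s` (idelic norm; continuity from that of
the norm, triviality on `Kˣ` from the product formula). [cite: TateThesis1967, §4.3 (p. 340)] -/
theorem exists_heckeCharacter_ideleNorm_cpow (s : ℂ) :
    ∃ χ : HeckeCharacter K, ∀ x : ideleGroup K,
      ((χ x : ℂˣ) : ℂ) = (GaloisRepresentations.ideleNorm x : ℂ) ^ s := by
  have hpos : ∀ x : ideleGroup K, (0 : ℝ) < (IdeleClassGroup.ideleNorm K x : ℝ) := fun x =>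
    NNReal.coe_pos.2 (pos_iff_ne_zero.2 (ideleNorm_ne_zero x))
  have hne : ∀ x : ideleGroup K, ((IdeleClassGroup.ideleNorm K x : ℝ) : ℂ) ^ s ≠ 0 := fun x h =>
    (hpos x).ne' (Complex.ofReal_eq_zero.1 (Complex.cpow_eq_zero_iff _ _ |>.1 h).1)
  have hcont : Continuous fun x : ideleGroup K => ((IdeleClassGroup.ideleNorm K x : ℝ) : ℂ) ^ s :=
    (Complex.continuous_ofReal.comp (NNReal.continuous_coe.comp (continuous_ideleNorm_holds K))).cpow
      continuous_const fun x => Complex.ofReal_mem_slitPlane.2 (hpos x)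
  let f : ideleGroup K →* ℂˣ :=
    { toFun := fun x => Units.mk0 (((IdeleClassGroup.ideleNorm K x : ℝ) : ℂ) ^ s) (hne x)
      map_one' := Units.ext (by
        rw [Units.val_mk0, map_one, NNReal.coe_one, Complex.ofReal_one, Complex.one_cpow,
          Units.val_one])
      map_mul' := fun x y => Units.ext (by
        simp only [Units.val_mk0, map_mul, NNReal.coe_mul, Complex.ofReal_mul, Units.val_mul]
        exact Complex.mul_cpow_ofReal_nonneg (NNReal.coe_nonneg _) (NNReal.coe_nonneg _) s) }
  have hf : ∀ x, ((f x : ℂˣ) : ℂ) = ((IdeleClassGroup.ideleNorm K x : ℝ) : ℂ) ^ s := fun x => rfl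
  have hfc : Continuous f := by
    refine Units.continuous_iff.mpr ⟨?_, ?_⟩
    · exact hcont.congr fun x => (hf x).symm
    · have : (fun x => ((f x)⁻¹ : ℂˣ).val) = fun x => ((((IdeleClassGroup.ideleNorm K x : ℝ) : ℂ) ^ s)⁻¹) := by
        funext x; rw [Units.val_inv_eq_inv_val, hf]
      rw [this]
      exact hcont.inv₀ hne
  let χ : HeckeCharacter K :=
    { toContinuousMonoidHom := { toMonoidHom := f, continuous_toFun := hfc }
      map_principal' := fun x hx => Units.ext (by
        change ((IdeleClassGroup.ideleNorm K x : ℝ) : ℂ) ^ s = 1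
        rw [ideleNorm_principal hx, NNReal.coe_one, Complex.ofReal_one, Complex.one_cpow]) }
  refine ⟨χ, fun x => ?_⟩
  change ((IdeleClassGroup.ideleNorm K x : ℝ) : ℂ) ^ s = _
  rw [coe_ideleNorm]

/-! ### `|det|_𝔸` on compact subgroups of `GL_n(𝔸_K^∞)`, on `A_G` and on the Hecke matrices -/

variable (n K) in
/-- **`|det u|_𝔸 = 1` on every compact subgroup `U₀` of `GL_n(𝔸_K^∞)`**: `u ↦ |det (1, u)|_𝔸` is a
continuous homomorphism `U₀ → ℝ_{>0}` whose image is compact, hence bounded, and a bounded subgroup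
of `ℝ_{>0}` is trivial. (Consequently `|det|_𝔸^s` is trivial on every level
`U ∈ finiteLevelsGL`.) [folklore] -/
theorem ideleNorm_det_ofFinite_eq_one_of_isCompact
    {U₀ : Subgroup (GL (Fin n) (FiniteAdeleRing (𝓞 K) K))}
    (hU₀ : IsCompact (U₀ : Set (GL (Fin n) (FiniteAdeleRing (𝓞 K) K)))) {u : GL (Fin n) (FiniteAdeleRing (𝓞 K) K)}
    (hu : u ∈ U₀) :
    IdeleClassGroup.ideleNorm K (Matrix.GeneralLinearGroup.det (GLn.ofFinite n K u)) = 1 := by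
  set φ : GL (Fin n) (FiniteAdeleRing (𝓞 K) K) →* ℝ≥0 :=
    (IdeleClassGroup.ideleNorm K).comp (Matrix.GeneralLinearGroup.det.comp (GLn.ofFinite n K)) with hφ
  have hφc : Continuous φ := (continuous_ideleNorm_holds K).comp
    (Matrix.GeneralLinearGroup.continuous_det.comp (GLn.continuous_ofFinite n K))
  change φ u = 1
  -- the image of `U₀` is bounded
  obtain ⟨B, hB⟩ := (hU₀.image hφc).bddAbove
  have hbound : ∀ w ∈ U₀, (φ w : ℝ) ≤ B := fun w hw => by
    exact_mod_cast hB ⟨w, hw, rfl⟩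
  have hne : ∀ w, φ w ≠ 0 := fun w => ideleNorm_ne_zero _
  -- no element of a bounded subgroup of `ℝ_{>0}` exceeds `1`
  have hle : ∀ w ∈ U₀, (φ w : ℝ) ≤ 1 := by
    intro w hw
    by_contra hlt
    rw [not_le] at hlt
    obtain ⟨k, hk⟩ := pow_unbounded_of_one_lt (B : ℝ) hlt
    have := hbound (w ^ k) (U₀.pow_mem hw k)
    rw [map_pow, NNReal.coe_pow] at this
    exact absurd (hk.trans_le this) (lt_irrefl _)
  have hinv : (φ u⁻¹ : ℝ) = (φ u : ℝ)⁻¹ := by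
    have h1 : φ u⁻¹ * φ u = 1 := by rw [← map_mul, inv_mul_cancel, map_one]
    exact_mod_cast eq_inv_of_mul_eq_one_left h1
  have h1 := hle u hu
  have h2 := hle u⁻¹ (U₀.inv_mem hu)
  rw [hinv] at h2
  have hpos : (0 : ℝ) < φ u := NNReal.coe_pos.2 (pos_iff_ne_zero.2 (hne u))
  have h3 : (1 : ℝ) ≤ φ u := by
    rwa [inv_le_one₀ hpos] at h2
  exact_mod_cast le_antisymm h1 h3

/-- `|det u|_𝔸^s = 1` (any Hecke character which is a function of the norm) on a level of `GL_n`: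
for `U ∈ finiteLevelsGL n K` (the image of a compact open `U₀ ≤ GL_n(𝔸_K^∞)`) and `χ(x) = ‖x‖^s`,
`χ (det u) = 1` for `u ∈ U`. [folklore] -/
theorem apply_det_eq_one_of_mem_finiteLevelsGL {χ : HeckeCharacter K} {s : ℂ}
    (hχ : ∀ x : ideleGroup K, ((χ x : ℂˣ) : ℂ) = (GaloisRepresentations.ideleNorm x : ℂ) ^ s)
    {U : Subgroup (GL (Fin n) (AdeleRing (𝓞 K) K))} (hU : U ∈ finiteLevelsGL n K) {u : GL (Fin n) (AdeleRing (𝓞 K) K)}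
    (hu : u ∈ U) : χ (Matrix.GeneralLinearGroup.det u) = 1 := by
  obtain ⟨U₀, -, hU₀c, rfl⟩ := hU
  obtain ⟨u₀, hu₀, rfl⟩ := hu
  refine Units.ext ?_
  rw [hχ, ← coe_ideleNorm, ideleNorm_det_ofFinite_eq_one_of_isCompact n K hU₀c hu₀, NNReal.coe_one,
    Complex.ofReal_one, Complex.one_cpow, Units.val_one]

/-- **`|det a|_𝔸 = a^{n [K:ℚ]}` on the split component `A_G`**: `det (a · 1_n) = ρ(a)^n` for the
positive real scalar idele `ρ(a)`, of norm `a^{[K:ℚ]}` (`ideleNorm_posRealIdele`). [folklore] -/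
theorem ideleNorm_det_posRealScalar (t : ℝ≥0ˣ) :
    IdeleClassGroup.ideleNorm K (Matrix.GeneralLinearGroup.det (posRealScalar n K t)) =
      ((t : ℝ≥0)) ^ (n * Module.finrank ℚ K) := by
  rw [posRealScalar, MonoidHom.comp_apply, Matrix.GeneralLinearGroup.det_scalar, Fintype.card_fin,
    map_pow, ideleNorm_posRealIdele_holds K t, ← pow_mul, mul_comm]

/-- **`|det t_{v,i}|_𝔸 = q_v^{-i}`** for the Hecke matrix `t_{v,i} = diag(ϖ, …, ϖ, 1, …, 1)`
(`det t_{v,i} = ϖ^i`, `det_heckeDiagAt`; `|ϖ|_v = q_v⁻¹`). [folklore] -/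
theorem ideleNorm_det_heckeDiagAt {v : HeightOneSpectrum (𝓞 K)} {ϖ : (v.adicCompletion K)ˣ}
    (hϖ : Valued.v (ϖ : v.adicCompletion K) = WithZero.exp (-1 : ℤ)) {i : ℕ} (hi : i ≤ n) :
    GaloisRepresentations.ideleNorm (Matrix.GeneralLinearGroup.det (heckeDiagAt n K v ϖ i)) =
      ((v.residueCard : ℝ)⁻¹) ^ i := by
  -- `|ϖ|_v = q_v⁻¹` (Mathlib's norm on `K_v`, `FinitePlace.norm_def`, base `absNorm v = q_v`; the same
  -- computation as `norm_eq_inv_residueCard_of_valued_eq` of `GJUnfoldingLocal`, inlined to keep the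
  -- imports of this file light)
  have hnorm : ‖(ϖ : v.adicCompletion K)‖ = (v.residueCard : ℝ)⁻¹ := by
    rw [FinitePlace.norm_def, hϖ, WithZero.exp, WithZeroMulInt.toNNReal_neg_apply _ WithZero.coe_ne_zero,
      WithZero.unzero_coe, toAdd_ofAdd, zpow_neg, zpow_one, NNReal.coe_inv, NNReal.coe_natCast]
    rfl
  rw [det_heckeDiagAt v ϖ hi, ← coe_ideleNorm, map_pow, NNReal.coe_pow, coe_ideleNorm,
    GaloisRepresentations.ideleNorm_localUnits, hnorm]

/-! ### The archimedean factor: `|det (g_∞, 1)|_𝔸 = N(det g_∞)` and `|det (exp X, 1)|_𝔸 = e^{λ(X)}` -/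

/-- **The norm of the infinite adele ring is the norm of the mixed space**: for
`x ∈ K_∞ = ∏_{w ∣ ∞} K_w`, `∏_w ‖x_w‖^{[K_w:ℝ]}` (Mathlib's `‖x‖` on `InfiniteAdeleRing K`) is
`mixedEmbedding.norm` of the image of `x` in `ℝ^{r₁} × ℂ^{r₂}` under `ringEquiv_mixedSpace` (the
component isomorphisms `K_w ≅ ℝ, ℂ` are isometries). [folklore] -/
theorem norm_eq_mixedEmbedding_norm_ringEquiv_mixedSpace (x : InfiniteAdeleRing K) :
    ‖x‖ = mixedEmbedding.norm (InfiniteAdeleRing.ringEquiv_mixedSpace K x) := by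
  rw [InfiniteAdeleRing.norm_def, mixedEmbedding.norm_apply]
  refine Finset.prod_congr rfl fun w _ => ?_
  congr 1
  by_cases hw : IsReal w
  · rw [normAtPlace_apply_of_isReal hw, InfiniteAdeleRing.ringEquiv_mixedSpace_apply]
    exact ((Completion.isometry_extensionEmbeddingOfIsReal hw).norm_map_of_map_zero (map_zero _) _).symm
  · rw [normAtPlace_apply_of_isComplex (not_isReal_iff_isComplex.1 hw),
      InfiniteAdeleRing.ringEquiv_mixedSpace_apply]
    exact ((Completion.isometry_extensionEmbedding w).norm_map_of_map_zero (map_zero _) _).symm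

/-- The archimedean component of `det (g, 1)`, `(g, 1) ∈ GL_n(K_∞ × 𝔸_K^∞)`: the determinant of
`g` transported along `ringEquiv_mixedSpace` (`det` commutes with the projection `GLn.fstHom`,
`Matrix.GeneralLinearGroup.map_det`). [folklore] -/
theorem coe_det_ofInfinite_fst (g : GL (Fin n) (mixedSpace K)) :
    ((Matrix.GeneralLinearGroup.det (GLn.ofInfinite n K g) : ideleGroup K) : AdeleRing (𝓞 K) K).1 =
      (InfiniteAdeleRing.ringEquiv_mixedSpace K).symm (g : Matrix (Fin n) (Fin n) (mixedSpace K)).det := by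
  have h := Matrix.GeneralLinearGroup.map_det
    (f := RingHom.fst (InfiniteAdeleRing K) (FiniteAdeleRing (𝓞 K) K)) (GLn.ofInfinite n K g)
  have h2 : ((Matrix.GeneralLinearGroup.det (GLn.ofInfinite n K g) : ideleGroup K) :
      AdeleRing (𝓞 K) K).1 = ((Matrix.GeneralLinearGroup.det (GLn.fstHom n K (GLn.ofInfinite n K g)) :
        (InfiniteAdeleRing K)ˣ) : InfiniteAdeleRing K) := by
    change _ = ((Matrix.GeneralLinearGroup.det ((Matrix.GeneralLinearGroup.map
      (RingHom.fst (InfiniteAdeleRing K) (FiniteAdeleRing (𝓞 K) K))) (GLn.ofInfinite n K g)) :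
        (InfiniteAdeleRing K)ˣ) : InfiniteAdeleRing K)
    rw [h]; rfl
  rw [h2, GLn.fstHom_ofInfinite, Matrix.GeneralLinearGroup.val_det_apply]
  exact (RingHom.map_det ((InfiniteAdeleRing.ringEquiv_mixedSpace K).symm : mixedSpace K →+* InfiniteAdeleRing K)
    (g : Matrix (Fin n) (Fin n) (mixedSpace K))).symm

/-- The finite component of `det (g, 1)` is `1`. [folklore] -/
theorem coe_det_ofInfinite_snd (g : GL (Fin n) (mixedSpace K)) :
    ((Matrix.GeneralLinearGroup.det (GLn.ofInfinite n K g) : ideleGroup K) : AdeleRing (𝓞 K) K).2 = 1 := by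
  have h := Matrix.GeneralLinearGroup.map_det
    (f := RingHom.snd (InfiniteAdeleRing K) (FiniteAdeleRing (𝓞 K) K)) (GLn.ofInfinite n K g)
  have h2 : ((Matrix.GeneralLinearGroup.det (GLn.ofInfinite n K g) : ideleGroup K) :
      AdeleRing (𝓞 K) K).2 = ((Matrix.GeneralLinearGroup.det (GLn.sndHom n K (GLn.ofInfinite n K g)) :
        (FiniteAdeleRing (𝓞 K) K)ˣ) : FiniteAdeleRing (𝓞 K) K) := by
    change _ = ((Matrix.GeneralLinearGroup.det ((Matrix.GeneralLinearGroup.map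
      (RingHom.snd (InfiniteAdeleRing K) (FiniteAdeleRing (𝓞 K) K))) (GLn.ofInfinite n K g)) :
        (FiniteAdeleRing (𝓞 K) K)ˣ) : FiniteAdeleRing (𝓞 K) K)
    rw [h]; rfl
  rw [h2, GLn.sndHom_ofInfinite, map_one, Units.val_one]

/-- **`|det (g_∞, 1)|_𝔸 = N(det g_∞)`**: the idelic norm of the determinant of an archimedean element
of `GL_n(𝔸_K)` is the mixed-space norm `∏_{w real} |·|_w ∏_{w complex} |·|_w²` of `det g_∞`.
[folklore] -/
theorem ideleNorm_det_ofInfinite (g : GL (Fin n) (mixedSpace K)) :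
    GaloisRepresentations.ideleNorm (Matrix.GeneralLinearGroup.det (GLn.ofInfinite n K g)) =
      mixedEmbedding.norm (g : Matrix (Fin n) (Fin n) (mixedSpace K)).det := by
  unfold GaloisRepresentations.ideleNorm
  rw [coe_det_ofInfinite_snd, ← InfiniteAdeleRing.norm_def, coe_det_ofInfinite_fst,
    norm_eq_mixedEmbedding_norm_ringEquiv_mixedSpace, RingEquiv.apply_symm_apply]
  have h1 : (fun v : HeightOneSpectrum (𝓞 K) => ‖(1 : FiniteAdeleRing (𝓞 K) K) v‖) = fun _ => 1 := by
    funext v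
    rw [show (1 : FiniteAdeleRing (𝓞 K) K) v = 1 from rfl, norm_one]
  rw [h1, finprod_one, mul_one]

/-- **`N(exp t) = e^{λ₀(t)}` on the mixed space**, with the real linear form
`λ₀(t) = ∑_{w real} t_w + ∑_{w complex} 2 re t_w`. [folklore] -/
theorem exists_linearMap_mixedEmbedding_norm_exp :
    ∃ lam₀ : mixedSpace K →ₗ[ℝ] ℝ, ∀ t : mixedSpace K, mixedEmbedding.norm (exp t) = Real.exp (lam₀ t) := by
  refine ⟨{ toFun := fun t => (∑ w, t.1 w) + ∑ w, 2 * (t.2 w).re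
            map_add' := fun t u => by
              simp only [Prod.fst_add, Prod.snd_add, Pi.add_apply, Complex.add_re, mul_add,
                Finset.sum_add_distrib]
              ring
            map_smul' := fun r t => by
              simp only [Prod.smul_fst, Prod.smul_snd, Pi.smul_apply, smul_eq_mul, Complex.real_smul,
                Complex.mul_re, Complex.ofReal_re, Complex.ofReal_im, zero_mul, sub_zero,
                RingHom.id_apply]
              rw [mul_add, Finset.mul_sum, Finset.mul_sum]
              refine congrArg₂ (· + ·) rfl (Finset.sum_congr rfl fun w _ => ?_)
              ring }, fun t => ?_⟩
  change mixedEmbedding.norm (exp t) = Real.exp ((∑ w, t.1 w) + ∑ w, 2 * (t.2 w).re)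
  rw [mixedEmbedding.norm_apply, ← Fintype.prod_subtype_mul_prod_subtype (fun w : InfinitePlace K => IsReal w),
    Real.exp_add, Real.exp_sum, Real.exp_sum]
  congr 1
  · refine Finset.prod_congr rfl fun w _ => ?_
    rw [mult_isReal, pow_one, normAtPlace_apply_of_isReal w.2, Prod.fst_exp, Pi.coe_exp,
      ← Real.exp_eq_exp_ℝ, Real.norm_eq_abs, Real.abs_exp]
  · rw [← (Equiv.subtypeEquivRight (fun w : InfinitePlace K => not_isReal_iff_isComplex)).prod_comp]
    refine Finset.prod_congr rfl fun w _ => ?_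
    rw [mult, if_neg w.2, normAtPlace_apply_of_isComplex (not_isReal_iff_isComplex.1 w.2),
      Prod.snd_exp, Pi.coe_exp, ← Complex.exp_eq_exp_ℂ, Complex.norm_exp, ← Real.exp_nat_mul,
      Nat.cast_ofNat, Equiv.subtypeEquivRight_apply]

variable (n K) in
/-- **`|det (exp X, 1)|_𝔸 = e^{λ(X)}` for `X ∈ 𝔤𝔩_n(K_∞)`**, with a real linear form `λ` on
`𝔤𝔩_n(K_∞) = M_n(ℝ^{r₁} × ℂ^{r₂})` vanishing on commutators: `λ(X) = λ₀(tr X) =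
∑_{w real} tr X_w + ∑_{w complex} 2 re tr X_w`, by `det (exp X) = exp (tr X)`
(`Literature.Analysis.Matrix.det_exp_eq_exp_trace`) and `N(exp t) = e^{λ₀(t)}`. This is the
hypothesis of `ArchimedeanCharacterTwist` for the characters `|det|_𝔸^s` of `GL_n(𝔸_K)`.
Borel–Jacquet 1979, 5.7 (the twist `π ⊗ |det|^s`). [cite: BorelJacquetCorvallis1979, 5.7] -/
theorem exists_linearMap_ideleNorm_det_ofInfinite_expGL :
    ∃ lam : Matrix (Fin n) (Fin n) (mixedSpace K) →ₗ[ℝ] ℝ, (∀ X Y, lam (X * Y - Y * X) = 0) ∧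
      ∀ X : Matrix (Fin n) (Fin n) (mixedSpace K),
        GaloisRepresentations.ideleNorm (Matrix.GeneralLinearGroup.det (GLn.ofInfinite n K (expGL X))) =
          Real.exp (lam X) := by
  obtain ⟨lam₀, hlam₀⟩ := exists_linearMap_mixedEmbedding_norm_exp (K := K)
  refine ⟨lam₀.comp (Matrix.traceLinearMap (Fin n) ℝ (mixedSpace K)), fun X Y => ?_, fun X => ?_⟩
  · rw [LinearMap.comp_apply, Matrix.traceLinearMap_apply, Matrix.trace_sub, Matrix.trace_mul_comm,
      sub_self, map_zero]
  · rw [ideleNorm_det_ofInfinite, coe_expGL, Literature.Analysis.Matrix.det_exp_eq_exp_trace, hlam₀,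
      LinearMap.comp_apply, Matrix.traceLinearMap_apply]

/-! ### `|det g|_𝔸` is polynomially bounded by the height: moderate growth of `|det|_𝔸^s` -/

/-- **Ultrametric determinant bound**: over an ultrametric normed commutative ring with `‖1‖ = 1`, if
all entries of `M` have norm `≤ B` (`B ≥ 0`) then `‖det M‖ ≤ B^m`. [folklore] -/
theorem norm_det_le_pow_of_isUltrametricDist {R : Type*} [NormedCommRing R] [IsUltrametricDist R]
    [NormOneClass R] {m : Type*} [Fintype m] [DecidableEq m] (M : Matrix m m R) {B : ℝ}
    (hB : 0 ≤ B) (h : ∀ i j, ‖M i j‖ ≤ B) : ‖M.det‖ ≤ B ^ Fintype.card m := by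
  rw [Matrix.det_apply']
  refine IsUltrametricDist.norm_sum_le_of_forall_le_of_nonneg (pow_nonneg hB _) fun σ _ => ?_
  refine (norm_mul_le _ _).trans ?_
  have hε : ‖((Equiv.Perm.sign σ : ℤ) : R)‖ ≤ 1 := by
    rcases Int.units_eq_one_or (Equiv.Perm.sign σ) with hσ | hσ <;> rw [hσ]
    · rw [Units.val_one, Int.cast_one, norm_one]
    · rw [Units.val_neg, Units.val_one, Int.cast_neg, Int.cast_one, norm_neg, norm_one]
  have hprod : ‖∏ i, M (σ i) i‖ ≤ B ^ Fintype.card m :=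
    calc ‖∏ i, M (σ i) i‖ ≤ ∏ i, ‖M (σ i) i‖ := Finset.norm_prod_le _ _
      _ ≤ ∏ _i : m, B := Finset.prod_le_prod (fun _ _ => norm_nonneg _) fun i _ => h _ _
      _ = B ^ Fintype.card m := by rw [Finset.prod_const, Finset.card_univ]
  calc _ ≤ 1 * B ^ Fintype.card m := mul_le_mul hε hprod (norm_nonneg _) zero_le_one
    _ = _ := one_mul _

/-- **The archimedean factor of `|det g|_𝔸` is bounded by the archimedean height**:
`‖(det g)_∞‖ = N(det g_∞) ≤ (n! H_∞(g)^n)^{[K:ℚ]}`. [folklore] -/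
theorem norm_det_fst_le_archHeight [NeZero n] (g : GL (Fin n) (AdeleRing (𝓞 K) K)) :
    ‖((Matrix.GeneralLinearGroup.det g : ideleGroup K) : AdeleRing (𝓞 K) K).1‖ ≤
      ((n.factorial : ℝ) * (GLn.archHeight n K g : ℝ) ^ n) ^ Module.finrank ℚ K := by
  haveI : Nonempty (Fin n) := ⟨⟨0, Nat.pos_of_ne_zero (NeZero.ne n)⟩⟩
  -- `(det g)_∞ = det g_∞` transported to the mixed space
  have h := Matrix.GeneralLinearGroup.map_det
    (f := RingHom.fst (InfiniteAdeleRing K) (FiniteAdeleRing (𝓞 K) K)) g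
  have h1 : ((Matrix.GeneralLinearGroup.det g : ideleGroup K) : AdeleRing (𝓞 K) K).1 =
      ((Matrix.GeneralLinearGroup.det (GLn.fstHom n K g) : (InfiniteAdeleRing K)ˣ) : InfiniteAdeleRing K) := by
    change _ = ((Matrix.GeneralLinearGroup.det ((Matrix.GeneralLinearGroup.map
      (RingHom.fst (InfiniteAdeleRing K) (FiniteAdeleRing (𝓞 K) K))) g) :
        (InfiniteAdeleRing K)ˣ) : InfiniteAdeleRing K)
    rw [h]; rfl
  have h2 : InfiniteAdeleRing.ringEquiv_mixedSpace K
      ((Matrix.GeneralLinearGroup.det (GLn.fstHom n K g) : (InfiniteAdeleRing K)ˣ) : InfiniteAdeleRing K) =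
      (GLn.toMixed n K g : Matrix (Fin n) (Fin n) (mixedSpace K)).det := by
    rw [Matrix.GeneralLinearGroup.val_det_apply]
    exact RingHom.map_det (InfiniteAdeleRing.ringEquiv_mixedSpace K : InfiniteAdeleRing K →+* mixedSpace K) _
  rw [h1, norm_eq_mixedEmbedding_norm_ringEquiv_mixedSpace, h2]
  refine (mixedEmbedding_norm_le_norm_pow K _).trans (pow_le_pow_left₀ (norm_nonneg _) ?_ _)
  have hdet := norm_det_le_of_forall_norm_le
    (A := (GLn.toMixed n K g : Matrix (Fin n) (Fin n) (mixedSpace K))) (c := (GLn.archHeight n K g : ℝ))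
    (fun i j => by exact_mod_cast nnnorm_apply_le_sup (GLn.toMixed n K g) i j)
  rwa [Fintype.card_fin] at hdet

/-- **The local factors of `|det g|_𝔸` are bounded by the local heights**: `‖(det g)_v‖_v ≤ H_v(g)^n`
(ultrametric determinant bound). [folklore] -/
theorem norm_det_snd_le_localHeight (g : GL (Fin n) (AdeleRing (𝓞 K) K)) (v : HeightOneSpectrum (𝓞 K)) :
    ‖((Matrix.GeneralLinearGroup.det g : ideleGroup K) : AdeleRing (𝓞 K) K).2 v‖ ≤
      (GLn.localHeight n K v g : ℝ) ^ n := by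
  have h1 : ((Matrix.GeneralLinearGroup.det g : ideleGroup K) : AdeleRing (𝓞 K) K).2 v =
      (Matrix.GeneralLinearGroup.map (AdelicGroupData.adeleEval K v) g : Matrix (Fin n) (Fin n)
        (v.adicCompletion K)).det := by
    rw [← AdelicGroupData.adeleEval_apply, Matrix.GeneralLinearGroup.val_det_apply]
    exact RingHom.map_det _ _
  rw [h1]
  have hdet := norm_det_le_pow_of_isUltrametricDist
    (Matrix.GeneralLinearGroup.map (AdelicGroupData.adeleEval K v) g : Matrix (Fin n) (Fin n)
      (v.adicCompletion K)) (B := (GLn.localHeight n K v g : ℝ)) (NNReal.coe_nonneg _)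
    (fun i j => by exact_mod_cast nnnorm_apply_le_sup (Matrix.GeneralLinearGroup.map
      (AdelicGroupData.adeleEval K v) g) i j)
  rwa [Fintype.card_fin] at hdet

/-- **`|det g|_𝔸 ≤ (n!)^{[K:ℚ]} (1 ⊔ ‖g‖)^{n [K:ℚ]}`**: the idelic norm of the determinant is
polynomially bounded by the adelic height `‖g‖ = H_∞(g) ∏_v H_v(g)` of Borel–Jacquet
(`adelicHeightGL`; `n ≥ 1`). Borel–Jacquet 1979, §1.2 (properties of `‖·‖`) and §4.2 (d). [cite: BorelJacquetCorvallis1979, §1.2] -/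
theorem ideleNorm_det_le_height [NeZero n] (g : GL (Fin n) (AdeleRing (𝓞 K) K)) :
    GaloisRepresentations.ideleNorm (Matrix.GeneralLinearGroup.det g) ≤
      (n.factorial : ℝ) ^ Module.finrank ℚ K * (1 ⊔ adelicHeightGL n K g) ^ (n * Module.finrank ℚ K) := by
  set d := Module.finrank ℚ K with hd
  set H : ℝ := (GLn.archHeight n K g : ℝ) with hH
  set P : ℝ := ∏ᶠ v, (GLn.localHeight n K v g : ℝ) with hP
  have hH0 : 0 < H := by exact_mod_cast GLn.archHeight_pos g
  have hP1 : 1 ≤ P := GLn.one_le_finprod_localHeight g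
  have hd1 : 1 ≤ d := Module.finrank_pos
  -- the finite part
  have hfinH : Function.HasFiniteMulSupport fun v => (GLn.localHeight n K v g : ℝ) := by
    refine (GLn.mulSupport_localHeight_finite_holds g).subset fun v hv => ?_
    simpa [Function.mem_mulSupport] using hv
  have hfinHn : Function.HasFiniteMulSupport fun v => (GLn.localHeight n K v g : ℝ) ^ n := by
    refine hfinH.subset fun v hv => ?_
    simp only [Function.mem_mulSupport] at hv ⊢
    exact fun h1 => hv (by rw [h1, one_pow])
  have hfinN : Function.HasFiniteMulSupport fun v =>
      ‖((Matrix.GeneralLinearGroup.det g : ideleGroup K) : AdeleRing (𝓞 K) K).2 v‖ := by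
    refine (hasFiniteMulSupport_nnnorm K (Matrix.GeneralLinearGroup.det g)).subset fun v hv => ?_
    simp only [Function.mem_mulSupport] at hv ⊢
    exact fun h1 => hv (by rw [← coe_nnnorm, h1, NNReal.coe_one])
  have hfin : ∏ᶠ v, ‖((Matrix.GeneralLinearGroup.det g : ideleGroup K) : AdeleRing (𝓞 K) K).2 v‖ ≤ P ^ n := by
    rw [hP, finprod_pow hfinH]
    exact finprod_le_finprod hfinN (fun _ => norm_nonneg _) hfinHn fun v => norm_det_snd_le_localHeight g v
  -- assemble
  unfold GaloisRepresentations.ideleNorm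
  rw [← InfiniteAdeleRing.norm_def]
  have harch := norm_det_fst_le_archHeight g
  calc ‖((Matrix.GeneralLinearGroup.det g : ideleGroup K) : AdeleRing (𝓞 K) K).1‖ *
        ∏ᶠ v, ‖((Matrix.GeneralLinearGroup.det g : ideleGroup K) : AdeleRing (𝓞 K) K).2 v‖
      ≤ ((n.factorial : ℝ) * H ^ n) ^ d * P ^ n :=
        mul_le_mul harch hfin (finprod_nonneg fun _ => norm_nonneg _) (pow_nonneg (by positivity) _)
    _ = (n.factorial : ℝ) ^ d * (H ^ (n * d) * P ^ n) := by rw [mul_pow, ← pow_mul, mul_assoc]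
    _ ≤ (n.factorial : ℝ) ^ d * (H ^ (n * d) * P ^ (n * d)) := by
        refine mul_le_mul_of_nonneg_left (mul_le_mul_of_nonneg_left ?_ (pow_nonneg hH0.le _))
          (pow_nonneg (Nat.cast_nonneg _) _)
        exact pow_le_pow_right₀ hP1 (Nat.le_mul_of_pos_right n hd1)
    _ = (n.factorial : ℝ) ^ d * (H * P) ^ (n * d) := by rw [mul_pow]
    _ ≤ (n.factorial : ℝ) ^ d * (1 ⊔ adelicHeightGL n K g) ^ (n * d) := by
        refine mul_le_mul_of_nonneg_left (pow_le_pow_left₀ (mul_nonneg hH0.le (zero_le_one.trans hP1))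
          ?_ _) (pow_nonneg (Nat.cast_nonneg _) _)
        exact le_sup_right

/-- `|det g⁻¹|_𝔸 = |det g|_𝔸⁻¹`. [folklore] -/
theorem ideleNorm_det_inv (g : GL (Fin n) (AdeleRing (𝓞 K) K)) :
    GaloisRepresentations.ideleNorm (Matrix.GeneralLinearGroup.det g⁻¹) =
      (GaloisRepresentations.ideleNorm (Matrix.GeneralLinearGroup.det g))⁻¹ := by
  rw [← coe_ideleNorm, ← coe_ideleNorm, map_inv, map_inv, NNReal.coe_inv]

/-- **`|det g|_𝔸^{-1} ≤ (n!)^{[K:ℚ]} (1 ⊔ ‖g‖)^{n [K:ℚ]}`** (the bound for `g⁻¹`, of the same height).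
Borel–Jacquet 1979, §1.2. [cite: BorelJacquetCorvallis1979, §1.2] -/
theorem ideleNorm_det_inv_le_height [NeZero n] (g : GL (Fin n) (AdeleRing (𝓞 K) K)) :
    (GaloisRepresentations.ideleNorm (Matrix.GeneralLinearGroup.det g))⁻¹ ≤
      (n.factorial : ℝ) ^ Module.finrank ℚ K * (1 ⊔ adelicHeightGL n K g) ^ (n * Module.finrank ℚ K) := by
  rw [← ideleNorm_det_inv, ← adelicHeightGL_inv g]
  exact ideleNorm_det_le_height g⁻¹

/-- **Moderate growth of `|det|_𝔸^σ`**: for every real `σ` there are `C > 0` and `r ∈ ℕ` with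
`|det g|_𝔸^σ ≤ C (1 ⊔ ‖g‖)^r` on `GL_n(𝔸_K)` (`n ≥ 1`) — condition (d) of Borel–Jacquet 1979, §4.2
for the twist `φ ↦ |det|^s φ` (`||det|^s| = |det|^{re s}`). [cite: BorelJacquetCorvallis1979, §4.2] -/
theorem exists_ideleNorm_det_rpow_le_height [NeZero n] (σ : ℝ) :
    ∃ (C : ℝ) (r : ℕ), 0 < C ∧ ∀ g : GL (Fin n) (AdeleRing (𝓞 K) K),
      GaloisRepresentations.ideleNorm (Matrix.GeneralLinearGroup.det g) ^ σ ≤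
        C * (1 ⊔ adelicHeightGL n K g) ^ r := by
  set d := Module.finrank ℚ K with hd
  set k : ℕ := ⌈|σ|⌉₊ with hk
  refine ⟨((n.factorial : ℝ) ^ d) ^ k, n * d * k, pow_pos (pow_pos (by positivity) _) _, fun g => ?_⟩
  set N : ℝ := GaloisRepresentations.ideleNorm (Matrix.GeneralLinearGroup.det g) with hN
  set M : ℝ := (n.factorial : ℝ) ^ d * (1 ⊔ adelicHeightGL n K g) ^ (n * d) with hM
  have hN0 : 0 < N := by
    rw [hN, ← coe_ideleNorm]
    exact NNReal.coe_pos.2 (pos_iff_ne_zero.2 (ideleNorm_ne_zero _))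
  have hM1 : 1 ≤ M := one_le_mul_of_one_le_of_one_le (one_le_pow₀ (by exact_mod_cast Nat.factorial_pos n))
    (one_le_pow₀ le_sup_left)
  have hNM : N ≤ M := ideleNorm_det_le_height g
  have hNM' : N⁻¹ ≤ M := ideleNorm_det_inv_le_height g
  -- `N^σ ≤ M^{|σ|} ≤ M^k`
  have h1 : N ^ σ ≤ M ^ |σ| := by
    rcases le_or_gt 0 σ with hσ | hσ
    · rw [abs_of_nonneg hσ]
      exact Real.rpow_le_rpow hN0.le hNM hσ
    · rw [abs_of_neg hσ]
      have : N ^ σ = N⁻¹ ^ (-σ) := by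
        rw [Real.inv_rpow hN0.le, Real.rpow_neg hN0.le, inv_inv]
      rw [this]
      exact Real.rpow_le_rpow (inv_nonneg.2 hN0.le) hNM' (neg_nonneg.2 hσ.le)
  have h2 : M ^ |σ| ≤ M ^ k := by
    have := Real.rpow_le_rpow_of_exponent_le hM1 (Nat.le_ceil |σ|)
    rwa [← hk, Real.rpow_natCast] at this
  refine (h1.trans h2).trans (le_of_eq ?_)
  rw [hM, mul_pow, ← pow_mul, ← pow_mul]

end Literature.NumberTheory.Automorphic
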